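import Literature.Analysis.FluidPDE.NSSliceTimeLimit
import Literature.Analysis.FluidPDE.NSBoundedInteriorRegularity
import HarnessLib

/-!
# Discharge of `NSSliceTimeContinuity`: joint continuity from spatially Hölder slices

This file proves the named fact `Literature.Analysis.FluidPDE.NSSliceTimeContinuity` of
`FluidPDE/NSBoundedInteriorRegularity` (`nsSliceTimeContinuity_holds`): a distributional
Navier–Stokes solution `(u, p)` in a centred cylinder `Q*_R(z) = I × B`, bounded a.e., with
`p ∈ L_{3/2}`, whose slices `u(t, ·)` are `(C, α)`-Hölder on `B` (a.e. `t`, `α > 0`), agrees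
a.e. on every `Q*_r(z)`, `r < R`, with a function continuous on `Q*_r(z)`.

Proof (folklore; the role of the pressure as in Robinson–Rodrigo–Sadowski 2016, §13.5):
1. (`FluidPDE/NSSliceTimePairing`, `FluidPDE/NSSliceTimeIncrement`) testing the equations with
   `χ(t) ρ(x - q) eᵢ` shows that each pairing `g(t) = ∫_B ⟪u(t), ρ(· - q) eᵢ⟫` is a.e. equal to
   `c + ∫ₐᵗ f` with `|∫ₛᵗ f| ≤ A |P(t) - P(s)|`, `P` the pressure clock `∫ₐᵗ (1 + ∫_B |p|)`;
2. countably many centres `qₖ` (a dense sequence), radii `δₙ → 0` and the three basis vectors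
   give one full-measure set `T` of good times, dense in `I`
   (`subset_closure_of_ae_restrict_mem`), on which all these identities hold and the Hölder
   representatives `v_t` exist;
3. (`FluidPDE/NSSliceTimeBumps`) for `t, s ∈ T` the representatives satisfy
   `‖v_t(y) - v_s(y)‖ ≤ 6 C δₙ^α + Aₙ |P(t) - P(s)|` on `B(x₀, r)` (`norm_sub_le_of_bump_pairings`);
4. (`FluidPDE/NSSliceTimeLimit`) hence they are uniformly Cauchy in `t` and extend to a function
   `W` continuous on `I × B(x₀, r)` with `W(t, ·) = v_t` for `t ∈ T`, which agrees with `u` a.e.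
   (`ae_eq_restrict_prod_of_ae_ae`).

## References

* J. C. Robinson, J. L. Rodrigo, W. Sadowski, *The three-dimensional Navier–Stokes equations*
  (CUP 2016), §13.5. [`RobinsonRodrigoSadowskiCUP2016`]
* G. Seregin, V. Šverák, Comm. PDE 34 (2009) = arXiv:0804.1803, Def. 2.1 and the remark following
  it (time regularity needs the pressure). [`SereginSverak2009`]
-/

noncomputable section

open MeasureTheory Set Function Filter Topology TopologicalSpace Metric
open scoped NNReal ENNReal InnerProductSpace RealInnerProductSpace Laplacian

namespace Literature.Analysis.FluidPDE

/-- **Discharge of `NSSliceTimeContinuity`** (module docstring for the proof). [folklore] -/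
theorem nsSliceTimeContinuity_holds : NSSliceTimeContinuity := by
  intro u p z R M C α hα hsol hbd hp hH r hr
  obtain ⟨hr0, hrR⟩ := hr
  have hR0 : 0 < R := hr0.trans hrR
  set a : ℝ := z.1 - R ^ 2 with ha
  set b : ℝ := z.1 + R ^ 2 with hb
  set B : Set (EuclideanSpace ℝ (Fin 3)) := ball z.2 R with hB
  set B' : Set (EuclideanSpace ℝ (Fin 3)) := ball z.2 r with hB'
  have hB'B : B' ⊆ B := ball_subset_ball hrR.le
  have hpi : IntegrableOn (uncurry p) (parabolicCylinderCentered R z) volume :=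
    integrableOn_pressure_of_lintegral hsol hp
  -- the bump scales `δ n → 0`, `0 < δ n < R - r`, and bumps of outer radius `δ n`
  set δ : ℕ → ℝ := fun n => (R - r) / ((n : ℝ) + 2) with hδ
  have hδ0 : ∀ n, 0 < δ n := fun n => by positivity
  have hδlt : ∀ n, δ n < R - r := fun n => by
    rw [hδ]
    dsimp only
    rw [div_lt_iff₀ (by positivity)]
    have hn : (0 : ℝ) ≤ n := n.cast_nonneg
    nlinarith
  have hδlim : Tendsto δ atTop (𝓝 0) := by
    have h1 : Tendsto (fun n : ℕ => (n : ℝ) + 2) atTop atTop :=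
      tendsto_atTop_add_const_right _ 2 tendsto_natCast_atTop_atTop
    exact tendsto_const_nhds.div_atTop h1
  have hφex : ∀ n, ∃ φ : ContDiffBump (0 : (EuclideanSpace ℝ (Fin 3))), φ.rOut = δ n := fun n =>
    ⟨⟨δ n / 2, δ n, half_pos (hδ0 n), half_lt_self (hδ0 n)⟩, rfl⟩
  choose φ hφ using hφex
  -- the basis vectors and a dense sequence of centres
  set e := EuclideanSpace.basisFun (Fin 3) ℝ with he
  obtain ⟨q, hq⟩ := TopologicalSpace.exists_dense_seq (EuclideanSpace ℝ (Fin 3))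
  -- the test fields, their uniform bounds, and the test property for centres in `B'`
  set η : ℕ → ℕ → Fin 3 → (EuclideanSpace ℝ (Fin 3)) → (EuclideanSpace ℝ (Fin 3)) :=
    fun n k i y => (φ n).normed volume (y - q k) • e i with hη
  have hKex : ∀ n i, ∃ K₁ K₂ : ℝ, ∀ (q' x : (EuclideanSpace ℝ (Fin 3))),
      ‖fderiv ℝ (fun y : (EuclideanSpace ℝ (Fin 3)) => (φ n).normed volume (y - q') • e i) x‖ ≤ K₁ ∧
        ‖Δ (fun y : (EuclideanSpace ℝ (Fin 3)) => (φ n).normed volume (y - q') • e i) x‖ ≤ K₂ :=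
    fun n i =>
    exists_bump_smul_bounds (φ n) (e i)
  choose K₁ K₂ hK using hKex
  have hK₁ : ∀ n k i x, ‖fderiv ℝ (η n k i) x‖ ≤ K₁ n i := fun n k i x => (hK n i (q k) x).1
  have hK₂ : ∀ n k i x, ‖Δ (η n k i) x‖ ≤ K₂ n i := fun n k i x => (hK n i (q k) x).2
  have hcb : ∀ n k, q k ∈ B' → closedBall (q k) (φ n).rOut ⊆ B := by
    intro n k hk x hx
    rw [mem_closedBall, hφ] at hx
    rw [hB', mem_ball] at hk
    rw [hB, mem_ball]
    linarith [dist_triangle x (q k) z.2, hδlt n]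
  have htest : ∀ n k i, q k ∈ B' →
      FunctionSpaces.IsTestFunctionOn ⟨B, isOpen_ball⟩ (η n k i) := fun n k i hk =>
    isTestFunctionOn_bump_smul (φ n) (q k) (e i) isOpen_ball (hcb n k hk)
  -- pairings, remainders, primitives, pressure clock, constants
  set g : ℕ → ℕ → Fin 3 → ℝ → ℝ := fun n k i t => ∫ x in B, ⟪u t x, η n k i x⟫ with hg
  set F : ℕ → ℕ → Fin 3 → ℝ → ℝ := fun n k i s => ∫ x in B,
    (⟪u s x, fderiv ℝ (η n k i) x (u s x)⟫ + ⟪u s x, Δ (η n k i) x⟫ +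
      p s x * VectorCalculus.divergence (η n k i) x) with hF
  set V : ℕ → ℕ → Fin 3 → ℝ → ℝ := fun n k i t => ∫ s in Ioc a t, F n k i s with hV
  set P : ℝ → ℝ := fun t => ∫ s in Ioc a t, (1 + ∫ x in B, |p s x|) with hP
  set A : ℕ → Fin 3 → ℝ := fun n i =>
    |(volume B).toReal * (K₁ n i * M ^ 2 + K₂ n i * M)| + 3 * |K₁ n i| with hA
  -- Step 1: the a.e. representations and the increment bounds
  have hrep : ∀ n k i, ∃ c : ℝ, q k ∈ B' → ∀ᵐ t ∂(volume.restrict (Ioo a b)),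
      g n k i t = c + V n k i t := by
    intro n k i
    by_cases hk : q k ∈ B'
    · obtain ⟨c, hc⟩ := exists_ae_pairing_eq_const_add_primitive hsol hbd hpi (htest n k i hk)
      exact ⟨c, fun _ => hc⟩
    · exact ⟨0, fun h => absurd h hk⟩
  choose c hc using hrep
  have hinc : ∀ n k i, q k ∈ B' → ∀ t ∈ Icc a b, ∀ s ∈ Icc a b,
      |V n k i t - V n k i s| ≤ A n i * |P t - P s| := fun n k i hk t ht s hs =>
    abs_primitive_sub_primitive_le hsol hbd hpi (htest n k i hk) (hK₁ n k i) (hK₂ n k i) ht hs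
  -- Step 2: the good set of times
  set T : Set ℝ := {t | t ∈ Ioo a b ∧
    (∃ v : (EuclideanSpace ℝ (Fin 3)) → (EuclideanSpace ℝ (Fin 3)),
      HolderOnWith C α v B ∧ u t =ᵐ[volume.restrict B] v) ∧
    ∀ n k i, q k ∈ B' → g n k i t = c n k i + V n k i t} with hT
  have hTfull : ∀ᵐ t ∂(volume.restrict (Ioo a b)), t ∈ T := by
    have h1 : ∀ᵐ t ∂(volume.restrict (Ioo a b)), t ∈ Ioo a b := ae_restrict_mem measurableSet_Ioo
    have h3 : ∀ᵐ t ∂(volume.restrict (Ioo a b)), ∀ n k i, q k ∈ B' →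
        g n k i t = c n k i + V n k i t := by
      rw [ae_all_iff]; intro n
      rw [ae_all_iff]; intro k
      rw [ae_all_iff]; intro i
      by_cases hk : q k ∈ B'
      · filter_upwards [hc n k i hk] with t ht _ using ht
      · exact Eventually.of_forall fun t h => absurd h hk
    filter_upwards [h1, hH, h3] with t h1t h2t h3t
    exact ⟨h1t, h2t, h3t⟩
  have hTI : T ⊆ Ioo a b := fun t ht => ht.1
  have hTcl : Ioo a b ⊆ closure T := subset_closure_of_ae_restrict_mem isOpen_Ioo hTfull
  -- Step 3: the Hölder representatives at good times
  have hvex : ∀ t, ∃ v : (EuclideanSpace ℝ (Fin 3)) → (EuclideanSpace ℝ (Fin 3)), t ∈ T →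
      HolderOnWith C α v B ∧ u t =ᵐ[volume.restrict B] v := by
    intro t
    by_cases ht : t ∈ T
    · obtain ⟨v, hv⟩ := ht.2.1
      exact ⟨v, fun _ => hv⟩
    · exact ⟨0, fun h => absurd h ht⟩
  choose vT hvT using hvex
  have hgv : ∀ t ∈ T, ∀ n k i, g n k i t = ∫ x in B, ⟪vT t x, η n k i x⟫ := by
    intro t ht n k i
    refine integral_congr_ae ?_
    filter_upwards [(hvT t ht).2] with x hx
    rw [hx]
  -- Step 4: the key estimate between two good slices
  have hkey : ∀ n, ∀ t ∈ T, ∀ s ∈ T, ∀ y ∈ B',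
      ‖vT t y - vT s y‖ ≤ 6 * C * δ n ^ ((α : ℝ)) + (∑ i, A n i) * |P t - P s| := by
    intro n t ht s hs y hy
    have hφn : (φ n).rOut < R - r := by rw [hφ]; exact hδlt n
    have key := norm_sub_le_of_bump_pairings hα (hvT t ht).1 (hvT s hs).1 (φ n) hφn hq
      (A := A n) (D := |P t - P s|) (fun k i hk => ?_) hy
    · rw [hφ] at key
      exact key
    · show |(∫ x in B, ⟪vT t x, η n k i x⟫) - ∫ x in B, ⟪vT s x, η n k i x⟫| ≤ A n i * |P t - P s|
      rw [← hgv t ht n k i, ← hgv s hs n k i, ht.2.2 n k i hk, hs.2.2 n k i hk,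
        add_sub_add_left_eq_sub]
      exact hinc n k i hk t (Ioo_subset_Icc_self ht.1) s (Ioo_subset_Icc_self hs.1)
  -- Step 5: the pressure clock is continuous; uniformly Cauchy; the limit
  have hPc : ∀ τ ∈ Ioo a b, ContinuousAt P τ := fun τ hτ =>
    (continuousOn_pressureClock hpi).continuousAt (Icc_mem_nhds hτ.1 hτ.2)
  have hω : Tendsto (fun n => 6 * (C : ℝ) * δ n ^ (α : ℝ)) atTop (𝓝 0) := by
    have h1 : Tendsto (fun n => δ n ^ (α : ℝ)) atTop (𝓝 0) := by
      have := hδlim.rpow_const (p := (α : ℝ)) (Or.inr α.2)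
      rwa [Real.zero_rpow (NNReal.coe_pos.2 hα).ne'] at this
    simpa using h1.const_mul (6 * (C : ℝ))
  have hosc := uniformly_cauchy_of_modulus (O := B') hPc hω hkey
  have hvc : ∀ t ∈ T, ContinuousOn (vT t) B' := fun t ht =>
    ((hvT t ht).1.continuousOn hα).mono hB'B
  obtain ⟨W, hWc, hWT⟩ := exists_continuousOn_of_uniformly_cauchy_slices hTI hTcl hvc hosc
  -- Step 6: conclusion on `Q*_r(z) = I' × B'`
  have hrr : r ^ 2 < R ^ 2 := by nlinarith
  have hI'I : Ioo (z.1 - r ^ 2) (z.1 + r ^ 2) ⊆ Ioo a b := Ioo_subset_Ioo (by linarith) (by linarith)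
  have hprod : parabolicCylinderCentered r z = Ioo (z.1 - r ^ 2) (z.1 + r ^ 2) ×ˢ B' := rfl
  refine ⟨W, ?_, ?_⟩
  · rw [hprod]
    exact hWc.mono (prod_mono hI'I Subset.rfl)
  · rw [hprod]
    refine ae_eq_restrict_prod_of_ae_ae ?_ ?_ ?_
    · have hsub : Ioo (z.1 - r ^ 2) (z.1 + r ^ 2) ×ˢ B' ⊆ parabolicCylinderCentered R z :=
        prod_mono hI'I hB'B
      exact (hsol.1.mono_set hsub).aestronglyMeasurable
    · exact (hWc.mono (prod_mono hI'I Subset.rfl)).aestronglyMeasurable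
        (measurableSet_Ioo.prod measurableSet_ball)
    · filter_upwards [ae_restrict_of_ae_restrict_of_subset hI'I hTfull] with t ht
      filter_upwards [ae_restrict_of_ae_restrict_of_subset hB'B (hvT t ht).2,
        ae_restrict_mem measurableSet_ball] with y hy hyB'
      simp only [uncurry_apply_pair]
      rw [hWT t ht y hyB', hy]

/-- **Discharge of `NSSliceTimeContinuity` under the canonical name** `<Fact>_holds`
(= `nsSliceTimeContinuity_holds`). [folklore] -/
theorem NSSliceTimeContinuity_holds : NSSliceTimeContinuity :=
  nsSliceTimeContinuity_holds

end Literature.Analysis.FluidPDE
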